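import Mathlib
import Summits.NavierStokesRegularity.NavierStokesRegularity.Theorems.EulerZoomLiouvillePowerGaugeEulerLiouvilleVorticityBirth
import Summits.NavierStokesRegularity.NavierStokesRegularity.Theorems.EulerZoomLiouvillePowerGaugeEulerLiouvilleDSSSimilarityTools
import HarnessLib.Audit

/-!
# Crux E `PowerGaugeEulerLiouville` (stmt-NavierStokesRegularity-19832): FOR A DSS MEMBER, A BACKWARD TRAJECTORY THAT COMES TO REST
# IN SIMILARITY VARIABLES CLUSTERS ON PERMANENT NODES (exactly self-similar particle paths); SUBCRITICAL PERMANENT NODES MAKE IT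
# EVENTUALLY SUBCRITICAL (key K-A″, DSS version, width seat ns-cas-k2 g2)

Route `EulerZoomLiouville` (NavierStokesRegularity), crux E.  Physical variables; class scaling `u(τ,y) = l^{1+ρ}u(l^{2+ρ}τ, ly)`,
`T = l^{2+ρ}`, `n = 1/(2+ρ)`; a particle path `X` of the classical flow on `(−∞,0)`, confined to the moving ball `‖X(s)‖ ≤ R(−s)ⁿ`
for `s ≤ τ₀`, whose SIMILARITY SPEED `(−s)^{1−n}‖u(s,X(s)) + (n/(−s))X(s)‖` tends to `0` as `s → −∞` (REST, e.g. from the pressure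
clock via `…SimilarityBernoulliRest`).  A point `y*` is a PERMANENT NODE if the exactly self-similar path `t ↦ (−t)ⁿ y*` is a particle
path: `u(t, (−t)ⁿy*) = −n(−t)^{n−1} y*` for ALL `t < 0`.
* `simVel_dss_iterate` — the similarity velocity `(−τ)^{1−n}(u(τ,x) + (n/(−τ))x)` is DSS-invariant (vector identity);
* `eventually_subcritical_of_permanentNodes` — if every permanent node `y*` with `‖y*‖ ≤ R` is SUBCRITICAL,
  `(−t)⟪∇u(t,(−t)ⁿy*)v, v⟫ ≤ κ‖v‖²` for all `t < 0`, `v` (one `κ < 1` for the ball), then along the resting confined trajectory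
  the stretching form is eventually subcritical: `⟪∇u(s, X(s))v, v⟫ ≤ κ'‖v‖²/(−s)` for `s ≤ σ₁`, any `κ' ∈ (κ, 1)`.  MECHANISM
  (compactness + periodicity): a bad sequence `s_j → −∞` is moved to the fundamental period `[−T,−1]` by `exists_fundamental_period`;
  the similarity positions, phases and directions subconverge; the limit position is a permanent node because over one period the
  resting orbit moves by `o(1)` in similarity variables while the phases `Tᵐt` of ANY `t < 0` visit every period (`exists_mem_Ico_zpow`);
  continuity of `(t,y,v) ↦ (−t)⟪∇u(t,(−t)ⁿy)v,v⟫` closes the contradiction.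

WHAT THIS IS NOT: not NS regularity, not the crux E — Lagrangian bookkeeping for hypothetical DSS blow-up members. [folklore]
-/

noncomputable section

set_option linter.dupNamespace false

open MeasureTheory Set Filter Topology Metric Function
open scoped NNReal ENNReal ContDiff InnerProductSpace RealInnerProductSpace

namespace Summit.NavierStokesRegularity.NavierStokesRegularity.Theorems.PowerGaugeEulerLiouville.SimilarityBernoulli

open Literature.Analysis Literature.Analysis.FluidPDE Literature.Analysis.FunctionSpaces
open Summit.NavierStokesRegularity.NavierStokesRegularity.Theorems.PowerGaugeEulerLiouville.VorticityBirth

variable {u : ℝ → EuclideanSpace ℝ (Fin 3) → EuclideanSpace ℝ (Fin 3)} {p : ℝ → EuclideanSpace ℝ (Fin 3) → ℝ} {ρ l : ℝ}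

/-! ### The fundamental period for far-past times, and period-translates inside a window -/

/-- For `τ ≤ −1` the fundamental representative is reached by a FORWARD iterate: `τ = Tᵐ t`, `t ∈ [−T,−1]`. [folklore] -/
theorem exists_fundamental_period_of_le {T : ℝ} (hT : 1 < T) {τ : ℝ} (hτ : τ ≤ -1) :
    ∃ m : ℕ, ∃ t : ℝ, t ∈ Icc (-T) (-1) ∧ τ = T ^ m * t := by
  obtain ⟨m, t, ht, h | h⟩ := exists_fundamental_period hT (by linarith : τ < 0)
  · exact ⟨m, t, ht, h⟩
  · refine ⟨0, τ, ⟨?_, hτ⟩, by simp⟩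
    have hTm : 1 ≤ T ^ m := one_le_pow₀ hT.le
    have : t ≤ τ := by rw [h]; nlinarith
    linarith [ht.1]

/-- **Period-translates of any phase visit every window**: `1 < T`, `t < 0`, `s ≤ t` ⇒ `∃ m : ℕ`, `T s ≤ Tᵐ t < s`. [folklore] -/
theorem exists_pow_mul_mem_window {T : ℝ} (hT : 1 < T) {t s : ℝ} (ht : t < 0) (hst : s ≤ t) :
    ∃ m : ℕ, T * s ≤ T ^ m * t ∧ T ^ m * t < s := by
  have hT0 : 0 < T := zero_lt_one.trans hT
  have hx : 0 < (-s) / (-t) := div_pos (by linarith) (by linarith)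
  obtain ⟨k, hk1, hk2⟩ := exists_mem_Ico_zpow hx hT
  have hx1 : 1 ≤ (-s) / (-t) := by rw [le_div_iff₀ (by linarith)]; linarith
  have hk0 : 0 ≤ k + 1 := by
    by_contra hneg
    push Not at hneg
    have : T ^ (k + 1) < 1 := zpow_lt_one_of_neg₀ hT (by omega)
    linarith [lt_of_le_of_lt hx1 hk2]
  obtain ⟨m, hm⟩ : ∃ m : ℕ, (m : ℤ) = k + 1 := ⟨(k + 1).toNat, Int.toNat_of_nonneg hk0⟩
  have hTm : (T ^ m : ℝ) = T ^ (k + 1) := by rw [← zpow_natCast, hm]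
  refine ⟨m, ?_, ?_⟩
  · have h1 : T ^ k * (-t) ≤ -s := by rwa [le_div_iff₀ (by linarith : 0 < -t)] at hk1
    have e : T ^ (k + 1) = T ^ k * T := zpow_add_one₀ hT0.ne' k
    rw [hTm, e]
    nlinarith
  · have h2 : -s < T ^ (k + 1) * (-t) := by rwa [div_lt_iff₀ (by linarith : 0 < -t)] at hk2
    rw [hTm]
    linarith

/-! ### The similarity velocity is DSS-invariant -/

/-- **DSS-invariance of the similarity velocity** (vector form):
`(−Tᵐτ)^{1−n} (u(Tᵐτ, lᵐx) + (n/(−Tᵐτ)) lᵐx) = (−τ)^{1−n} (u(τ,x) + (n/(−τ)) x)`, `n = 1/(2+ρ)`. [folklore] -/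
theorem simVel_dss_iterate (hl : 1 < l) (hρ : 0 < 2 + ρ)
    (hdss : ∀ τ : ℝ, τ < 0 → ∀ y, u τ y = (l ^ (1 + ρ)) • u ((l ^ (2 + ρ)) * τ) (l • y))
    (m : ℕ) {τ : ℝ} (hτ : τ < 0) (x : EuclideanSpace ℝ (Fin 3)) :
    (-((l ^ (2 + ρ)) ^ m * τ)) ^ (1 - (2 + ρ)⁻¹) •
        (u ((l ^ (2 + ρ)) ^ m * τ) (l ^ m • x) + ((2 + ρ)⁻¹ / (-((l ^ (2 + ρ)) ^ m * τ))) • (l ^ m • x)) =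
      (-τ) ^ (1 - (2 + ρ)⁻¹) • (u τ x + ((2 + ρ)⁻¹ / (-τ)) • x) := by
  have hl0 : 0 < l := zero_lt_one.trans hl
  have hK : 0 < (l ^ (1 + ρ)) ^ m := pow_pos (Real.rpow_pos_of_pos hl0 _) m
  have hlm : 0 < l ^ m := pow_pos hl0 m
  have hTm0 : 0 < (l ^ (2 + ρ)) ^ m := pow_pos (Real.rpow_pos_of_pos hl0 _) m
  have hτ0 : 0 < -τ := by linarith
  -- `u(Tᵐτ, lᵐx) = K⁻¹ u(τ, x)`
  have hu : u ((l ^ (2 + ρ)) ^ m * τ) (l ^ m • x) = ((l ^ (1 + ρ)) ^ m)⁻¹ • u τ x := by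
    rw [dss_iterate hl hρ hdss m hτ x, smul_smul, inv_mul_cancel₀ hK.ne', one_smul]
  have hpow : (-((l ^ (2 + ρ)) ^ m * τ)) ^ (1 - (2 + ρ)⁻¹) = (l ^ (1 + ρ)) ^ m * (-τ) ^ (1 - (2 + ρ)⁻¹) := by
    rw [show -((l ^ (2 + ρ)) ^ m * τ) = (l ^ (2 + ρ)) ^ m * (-τ) by ring, Real.mul_rpow hTm0.le hτ0.le,
      rpow_period_one_sub hl0 hρ m]
  have hT : (l ^ (2 + ρ)) ^ m = (l ^ (1 + ρ)) ^ m * l ^ m := period_pow_eq hl0 m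
  have hτne : τ ≠ 0 := ne_of_lt hτ
  rw [hu, hpow]
  simp only [smul_add, smul_smul]
  have e1 : (l ^ (1 + ρ)) ^ m * (-τ) ^ (1 - (2 + ρ)⁻¹) * ((l ^ (1 + ρ)) ^ m)⁻¹ = (-τ) ^ (1 - (2 + ρ)⁻¹) := by
    field_simp
  have e2 : (l ^ (1 + ρ)) ^ m * (-τ) ^ (1 - (2 + ρ)⁻¹) * ((2 + ρ)⁻¹ / -((l ^ (2 + ρ)) ^ m * τ) * l ^ m) =
      (-τ) ^ (1 - (2 + ρ)⁻¹) * ((2 + ρ)⁻¹ / -τ) := by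
    rw [hT]
    field_simp
  rw [e1, e2]

/-! ### The similarity position of a particle and its slow motion at rest -/

/-- The similarity position `y(s) = (−s)^{−n} X(s)` of a particle path has derivative `(−s)^{−1} · V(s)`, where
`V(s) = (−s)^{1−n}(u(s,X(s)) + (n/(−s))X(s))` is the similarity velocity. [folklore] -/
theorem hasDerivAt_simPos {X : ℝ → EuclideanSpace ℝ (Fin 3)} {n s : ℝ} (hs : s < 0)
    (hX : HasDerivAt X (u s (X s)) s) :
    HasDerivAt (fun σ => ((-σ) ^ (-n)) • X σ)
      ((-s)⁻¹ • ((-s) ^ (1 - n) • (u s (X s) + (n / (-s)) • X s))) s := by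
  have hs0 : 0 < -s := by linarith
  have hsne : s ≠ 0 := ne_of_lt hs
  have hpow : HasDerivAt (fun σ : ℝ => (-σ) ^ (-n)) ((-1) * (-n) * (-s) ^ (-n - 1)) s :=
    (hasDerivAt_neg s).rpow_const (Or.inl hs0.ne')
  have h := hpow.smul hX
  refine h.congr_deriv ?_
  simp only [smul_add, smul_smul]
  have e0 : (-s) ^ (1 - n) = (-s) * (-s) ^ (-n) := by
    rw [show (1 - n) = 1 + (-n) by ring, Real.rpow_add hs0, Real.rpow_one]
  have e1 : (-s)⁻¹ * (-s) ^ (1 - n) = (-s) ^ (-n) := by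
    rw [e0]; field_simp
  have e2 : (-s)⁻¹ * ((-s) ^ (1 - n) * (n / -s)) = -1 * -n * (-s) ^ (-n - 1) := by
    rw [e0, Real.rpow_sub_one hs0.ne']; field_simp
  rw [e1, e2, add_comm]

/-- **Slow motion at rest**: if `‖V(σ)‖ ≤ ε` for `σ ∈ [s', s]` (`s < 0`, `T s ≤ s'`, `T ≥ 1`), then the similarity positions
satisfy `‖y(s) − y(s')‖ ≤ ε (T − 1)`. [folklore] -/
theorem norm_simPos_sub_le {X : ℝ → EuclideanSpace ℝ (Fin 3)} {n T ε s' s : ℝ} (hs : s < 0) (hs's : s' ≤ s)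
    (hTs : T * s ≤ s') (hX : ∀ σ : ℝ, σ < 0 → HasDerivAt X (u σ (X σ)) σ)
    (hV : ∀ σ ∈ Icc s' s, ‖(-σ) ^ (1 - n) • (u σ (X σ) + (n / (-σ)) • X σ)‖ ≤ ε) :
    ‖((-s) ^ (-n)) • X s - ((-s') ^ (-n)) • X s'‖ ≤ ε * (T - 1) := by
  have hs0 : 0 < -s := by linarith
  have hε : 0 ≤ ε := (norm_nonneg _).trans (hV s (right_mem_Icc.2 hs's))
  have hmv := norm_image_sub_le_of_norm_deriv_le_segment' (f := fun σ => ((-σ) ^ (-n)) • X σ)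
    (f' := fun σ => (-σ)⁻¹ • ((-σ) ^ (1 - n) • (u σ (X σ) + (n / (-σ)) • X σ))) (a := s') (b := s) (C := ε / (-s))
    (fun σ hσ => (hasDerivAt_simPos (lt_of_le_of_lt hσ.2 hs) (hX σ (lt_of_le_of_lt hσ.2 hs))).hasDerivWithinAt)
    (fun σ hσ => by
      have hσ0 : 0 < -σ := by linarith [hσ.2]
      rw [norm_smul, Real.norm_eq_abs, abs_of_pos (inv_pos.2 hσ0)]
      calc (-σ)⁻¹ * ‖(-σ) ^ (1 - n) • (u σ (X σ) + (n / -σ) • X σ)‖ ≤ (-σ)⁻¹ * ε :=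
            mul_le_mul_of_nonneg_left (hV σ ⟨hσ.1, hσ.2.le⟩) (inv_pos.2 hσ0).le
        _ ≤ (-s)⁻¹ * ε := mul_le_mul_of_nonneg_right (by
            rw [inv_le_inv₀ hσ0 hs0]; linarith [hσ.2]) hε
        _ = ε / (-s) := by rw [div_eq_inv_mul])
    s (right_mem_Icc.2 hs's)
  refine hmv.trans ?_
  rw [div_mul_eq_mul_div, div_le_iff₀ hs0]
  have : s - s' ≤ (T - 1) * (-s) := by nlinarith
  nlinarith

/-! ### Quadratic-form and similarity-velocity transfers to the fundamental period -/

/-- Transfer of the scaled stretching form along a DSS iterate: with `s = Tᵐ t` and `X = lᵐ (−t)ⁿ y`,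
`(−s)⟪∇u(s, X)v, v⟫ = (−t)⟪∇u(t, (−t)ⁿ y)v, v⟫`. [folklore] -/
theorem stretching_transfer (hl : 1 < l) (hρ : 0 < 2 + ρ)
    (hdss : ∀ τ : ℝ, τ < 0 → ∀ y, u τ y = (l ^ (1 + ρ)) • u ((l ^ (2 + ρ)) * τ) (l • y))
    (m : ℕ) {t : ℝ} (ht : t < 0) (y v : EuclideanSpace ℝ (Fin 3)) :
    (-((l ^ (2 + ρ)) ^ m * t)) * ⟪fderiv ℝ (u ((l ^ (2 + ρ)) ^ m * t)) (l ^ m • ((-t) ^ (2 + ρ)⁻¹ • y)) v, v⟫ =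
      (-t) * ⟪fderiv ℝ (u t) ((-t) ^ (2 + ρ)⁻¹ • y) v, v⟫ := by
  have h := scaledFDeriv_dss_iterate hl hρ hdss m ht ((-t) ^ (2 + ρ)⁻¹ • y)
  have h' := congrArg (fun L : EuclideanSpace ℝ (Fin 3) →L[ℝ] EuclideanSpace ℝ (Fin 3) => ⟪L v, v⟫) h
  simpa only [FunLike.coe_smul, Pi.smul_apply, real_inner_smul_left] using h'

/-- The space scaling matches the similarity radius: `lᵐ (−t)ⁿ = (−Tᵐt)ⁿ`, `n = 1/(2+ρ)`. [folklore] -/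
theorem pow_mul_rpow_eq (hl : 1 < l) (hρ : 0 < 2 + ρ) (m : ℕ) {t : ℝ} (ht : t < 0) :
    l ^ m * (-t) ^ (2 + ρ)⁻¹ = (-((l ^ (2 + ρ)) ^ m * t)) ^ (2 + ρ)⁻¹ := by
  have hl0 : 0 < l := zero_lt_one.trans hl
  have hTm : 0 ≤ (l ^ (2 + ρ)) ^ m := pow_nonneg (Real.rpow_nonneg hl0.le _) m
  rw [show -((l ^ (2 + ρ)) ^ m * t) = (l ^ (2 + ρ)) ^ m * (-t) by ring, Real.mul_rpow hTm (by linarith),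
    rpow_period_inv hl0 hρ m]

/-! ### Resting trajectories cluster on permanent nodes: eventual subcriticality -/

/-- **SUBCRITICAL PERMANENT NODES MAKE A RESTING CONFINED TRAJECTORY EVENTUALLY SUBCRITICAL.**  `(u, p)` classical on `(−∞,0)`,
`l`-DSS for the class scaling; `X` a particle path confined to `‖X(s)‖ ≤ R(−s)ⁿ` for `s ≤ τ₀` (`n = 1/(2+ρ)`) whose similarity speed
tends to `0` at `−∞`; every permanent node `y*` of the ball `‖y*‖ ≤ R` subcritical with constant `κ`.  Then for every `κ' > κ` there is
`σ₁ ≤ τ₀` with `⟪∇u(s, X(s))v, v⟫ ≤ κ'‖v‖²/(−s)` for all `s ≤ σ₁`, `v`. [folklore] -/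
theorem eventually_subcritical_of_permanentNodes (hcl : IsClassicalEulerSolutionOn (Iio 0) 0 u p) (hl : 1 < l)
    (hρ : 0 < 2 + ρ) (hdss : ∀ τ : ℝ, τ < 0 → ∀ y, u τ y = (l ^ (1 + ρ)) • u ((l ^ (2 + ρ)) * τ) (l • y))
    {X : ℝ → EuclideanSpace ℝ (Fin 3)} {τ₀ R κ κ' : ℝ} (hκ : κ < κ')
    (hX : ∀ s : ℝ, s < 0 → HasDerivAt X (u s (X s)) s)
    (hconf : ∀ s : ℝ, s ≤ τ₀ → ‖X s‖ ≤ R * (-s) ^ (2 + ρ)⁻¹)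
    (hrest : Tendsto (fun s => (-s) ^ (1 - (2 + ρ)⁻¹) * ‖u s (X s) + ((2 + ρ)⁻¹ / (-s)) • X s‖) atBot (𝓝 0))
    (hnode : ∀ y : EuclideanSpace ℝ (Fin 3), ‖y‖ ≤ R →
      (∀ t : ℝ, t < 0 → u t ((-t) ^ (2 + ρ)⁻¹ • y) = (-((2 + ρ)⁻¹ * (-t) ^ ((2 + ρ)⁻¹ - 1))) • y) →
      ∀ t : ℝ, t < 0 → ∀ v : EuclideanSpace ℝ (Fin 3),
        (-t) * ⟪fderiv ℝ (u t) ((-t) ^ (2 + ρ)⁻¹ • y) v, v⟫ ≤ κ * ‖v‖ ^ 2) :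
    ∃ σ₁ : ℝ, σ₁ ≤ τ₀ ∧ ∀ s : ℝ, s ≤ σ₁ → ∀ v : EuclideanSpace ℝ (Fin 3),
      ⟪fderiv ℝ (u s) (X s) v, v⟫ ≤ κ' / (-s) * ‖v‖ ^ 2 := by
  have hl0 : 0 < l := zero_lt_one.trans hl
  set n : ℝ := (2 + ρ)⁻¹ with hn
  set T : ℝ := l ^ (2 + ρ) with hT
  have hT1 : 1 < T := Real.one_lt_rpow hl hρ
  have hT0 : 0 < T := zero_lt_one.trans hT1
  by_contra H
  push Not at H
  choose sq hsq vq hvq using fun j : ℕ => H (min τ₀ (-(j : ℝ) - 1)) (min_le_left _ _)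
  have hsqτ : ∀ j, sq j ≤ τ₀ := fun j => (hsq j).trans (min_le_left _ _)
  have hsqj : ∀ j, sq j ≤ -(j : ℝ) - 1 := fun j => (hsq j).trans (min_le_right _ _)
  have hsq1 : ∀ j, sq j ≤ -1 := fun j => (hsqj j).trans (by have := (Nat.cast_nonneg j : (0:ℝ) ≤ j); linarith)
  have hsq0 : ∀ j, sq j < 0 := fun j => by linarith [hsq1 j]
  have hvne : ∀ j, vq j ≠ 0 := by
    intro j h
    have := hvq j
    rw [h] at this
    simp at this
  set wq : ℕ → EuclideanSpace ℝ (Fin 3) := fun j => (‖vq j‖⁻¹) • vq j with hwq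
  have hwq1 : ∀ j, ‖wq j‖ = 1 := fun j => by
    simp only [hwq]; rw [norm_smul, Real.norm_eq_abs, abs_of_pos (inv_pos.2 (norm_pos_iff.2 (hvne j))),
      inv_mul_cancel₀ (norm_ne_zero_iff.2 (hvne j))]
  have hbad : ∀ j, κ' < (-sq j) * ⟪fderiv ℝ (u (sq j)) (X (sq j)) (wq j), wq j⟫ := by
    intro j
    have hs0 : 0 < -sq j := by linarith [hsq0 j]
    have hvpos : 0 < ‖vq j‖ := norm_pos_iff.2 (hvne j)
    have h1 := hvq j
    have e : ⟪fderiv ℝ (u (sq j)) (X (sq j)) (wq j), wq j⟫ =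
        ‖vq j‖⁻¹ ^ 2 * ⟪fderiv ℝ (u (sq j)) (X (sq j)) (vq j), vq j⟫ := by
      simp only [hwq, map_smul, real_inner_smul_left, real_inner_smul_right]; ring
    rw [e]
    have hsne : sq j ≠ 0 := (hsq0 j).ne
    have hvne' : ‖vq j‖ ≠ 0 := hvpos.ne'
    have h2 : κ' = (-sq j) * (‖vq j‖⁻¹ ^ 2 * (κ' / (-sq j) * ‖vq j‖ ^ 2)) := by
      field_simp
    rw [h2]
    exact mul_lt_mul_of_pos_left (mul_lt_mul_of_pos_left h1 (by positivity)) hs0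
  choose mq tq htq hst using fun j => exists_fundamental_period_of_le hT1 (hsq1 j)
  have htq0 : ∀ j, tq j < 0 := fun j => by linarith [(htq j).2]
  have hneg_inv : ∀ s : ℝ, s < 0 → (-s) ^ (-n) = ((-s) ^ n)⁻¹ := fun s hs => Real.rpow_neg (by linarith) n
  set yq : ℕ → EuclideanSpace ℝ (Fin 3) := fun j => ((-sq j) ^ (-n)) • X (sq j) with hyq
  have hyqR : ∀ j, ‖yq j‖ ≤ R := by
    intro j
    have hs0 : 0 < -sq j := by linarith [hsq0 j]
    have hp : 0 < (-sq j) ^ n := Real.rpow_pos_of_pos hs0 _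
    simp only [hyq]
    rw [norm_smul, Real.norm_eq_abs, hneg_inv _ (hsq0 j), abs_of_pos (inv_pos.2 hp), inv_mul_le_iff₀ hp, mul_comm]
    exact hconf (sq j) (hsqτ j)
  have hXy : ∀ j, l ^ (mq j) • ((-tq j) ^ n • yq j) = X (sq j) := by
    intro j
    have hs0 : 0 < -sq j := by linarith [hsq0 j]
    have hp : 0 < (-sq j) ^ n := Real.rpow_pos_of_pos hs0 _
    simp only [hyq]
    rw [smul_smul, smul_smul, pow_mul_rpow_eq hl hρ (mq j) (htq0 j), ← hT, ← hst j, hneg_inv _ (hsq0 j),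
      mul_inv_cancel₀ hp.ne', one_smul]
  have hbad' : ∀ j, κ' < (-tq j) * ⟪fderiv ℝ (u (tq j)) ((-tq j) ^ n • yq j) (wq j), wq j⟫ := by
    intro j
    have h := stretching_transfer hl hρ hdss (mq j) (htq0 j) (yq j) (wq j)
    rw [hXy j, ← hT, ← hst j] at h
    rw [← h]
    exact hbad j
  set Kc : Set (EuclideanSpace ℝ (Fin 3) × ℝ × EuclideanSpace ℝ (Fin 3)) :=
    closedBall 0 R ×ˢ (Icc (-T) (-1) ×ˢ sphere 0 1) with hKc
  have hKcpt : IsCompact Kc := (isCompact_closedBall _ _).prod (isCompact_Icc.prod (isCompact_sphere _ _))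
  set z : ℕ → EuclideanSpace ℝ (Fin 3) × ℝ × EuclideanSpace ℝ (Fin 3) := fun j => (yq j, tq j, wq j) with hz
  have hzK : ∀ j, z j ∈ Kc := fun j =>
    ⟨mem_closedBall_zero_iff.2 (hyqR j), htq j, mem_sphere_zero_iff_norm.2 (hwq1 j)⟩
  obtain ⟨zs, hzs, φ, hφ, hlim⟩ := hKcpt.tendsto_subseq hzK
  obtain ⟨ys, ts, ws⟩ := zs
  obtain ⟨hys, hts, hws⟩ := hzs
  rw [mem_closedBall_zero_iff] at hys
  rw [mem_sphere_zero_iff_norm] at hws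
  have hts0 : ts < 0 := by linarith [hts.2]
  have hy_lim : Tendsto (fun j => yq (φ j)) atTop (𝓝 ys) := (continuous_fst.tendsto _).comp hlim
  have ht_lim : Tendsto (fun j => tq (φ j)) atTop (𝓝 ts) :=
    (continuous_fst.tendsto _).comp ((continuous_snd.tendsto _).comp hlim)
  have hw_lim : Tendsto (fun j => wq (φ j)) atTop (𝓝 ws) :=
    (continuous_snd.tendsto _).comp ((continuous_snd.tendsto _).comp hlim)
  -- continuity of the scaled stretching form at `(ys, ts, ws)`
  have hDcont : ContinuousOn (uncurry fun t x => fderiv ℝ (u t) x) (Iio (0:ℝ) ×ˢ univ) :=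
    (hcl.smooth_velocity.fderiv_slice isOpen_Iio.uniqueDiffOn).continuousOn
  have hpt_lim : Tendsto (fun j => ((tq (φ j), (-tq (φ j)) ^ n • yq (φ j)) : ℝ × EuclideanSpace ℝ (Fin 3))) atTop
      (𝓝 (ts, (-ts) ^ n • ys)) := by
    refine ht_lim.prodMk_nhds ?_
    have hr : Tendsto (fun j => (-tq (φ j)) ^ n) atTop (𝓝 ((-ts) ^ n)) :=
      (ht_lim.neg).rpow_const (Or.inl (by linarith))
    exact hr.smul hy_lim
  have hA_lim : Tendsto (fun j => fderiv ℝ (u (tq (φ j))) ((-tq (φ j)) ^ n • yq (φ j))) atTop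
      (𝓝 (fderiv ℝ (u ts) ((-ts) ^ n • ys))) := by
    have hmem : (ts, (-ts) ^ n • ys) ∈ Iio (0:ℝ) ×ˢ (univ : Set (EuclideanSpace ℝ (Fin 3))) := ⟨hts0, mem_univ _⟩
    have h1 := (hDcont _ hmem).tendsto.comp (tendsto_nhdsWithin_iff.2 ⟨hpt_lim, Eventually.of_forall fun j =>
      ⟨htq0 (φ j), mem_univ _⟩⟩)
    exact h1
  have hAw_lim : Tendsto (fun j => fderiv ℝ (u (tq (φ j))) ((-tq (φ j)) ^ n • yq (φ j)) (wq (φ j))) atTop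
      (𝓝 (fderiv ℝ (u ts) ((-ts) ^ n • ys) ws)) :=
    (isBoundedBilinearMap_apply.continuous.tendsto _).comp (hA_lim.prodMk_nhds hw_lim)
  have hF_lim : Tendsto (fun j => (-tq (φ j)) * ⟪fderiv ℝ (u (tq (φ j))) ((-tq (φ j)) ^ n • yq (φ j)) (wq (φ j)), wq (φ j)⟫)
      atTop (𝓝 ((-ts) * ⟪fderiv ℝ (u ts) ((-ts) ^ n • ys) ws, ws⟫)) :=
    ht_lim.neg.mul (hAw_lim.inner hw_lim)
  have hFge : κ' ≤ (-ts) * ⟪fderiv ℝ (u ts) ((-ts) ^ n • ys) ws, ws⟫ :=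
    ge_of_tendsto hF_lim (Eventually.of_forall fun j => (hbad' (φ j)).le)
  -- `ys` is a PERMANENT NODE
  have hφge : ∀ j : ℕ, (j : ℝ) ≤ (φ j : ℝ) := fun j => by exact_mod_cast hφ.id_le j
  have hperm : ∀ t : ℝ, t < 0 → u t ((-t) ^ n • ys) = (-(n * (-t) ^ (n - 1))) • ys := by
    intro t ht
    have ht0' : 0 < -t := by linarith
    -- shift the subsequence so that `s_{φ(j+j₀)} ≤ t`
    set j₀ : ℕ := ⌈-t⌉₊ with hj₀
    have hle : ∀ j : ℕ, sq (φ (j + j₀)) ≤ t := by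
      intro j
      have h1 := hsqj (φ (j + j₀))
      have h2 := hφge (j + j₀)
      have h3 : (-t) ≤ (j₀ : ℝ) := Nat.le_ceil (-t)
      have h4 : (0 : ℝ) ≤ j := Nat.cast_nonneg j
      push_cast at h2
      linarith
    choose m' hm'1 hm'2 using fun j => exists_pow_mul_mem_window hT1 ht (hle j)
    set s' : ℕ → ℝ := fun j => T ^ (m' j) * t with hs'
    have hs'le : ∀ j, s' j ≤ sq (φ (j + j₀)) := fun j => (hm'2 j).le
    have hs'0 : ∀ j, s' j < 0 := fun j => lt_of_le_of_lt (hs'le j) (hsq0 _)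
    -- similarity position at `s' j` and the identity `G (y' j) = V (s' j)`
    set y' : ℕ → EuclideanSpace ℝ (Fin 3) := fun j => ((-s' j) ^ (-n)) • X (s' j) with hy'
    set G : EuclideanSpace ℝ (Fin 3) → EuclideanSpace ℝ (Fin 3) :=
      fun y => (-t) ^ (1 - n) • (u t ((-t) ^ n • y) + (n / (-t)) • ((-t) ^ n • y)) with hG
    have hGV : ∀ j, G (y' j) = (-s' j) ^ (1 - n) • (u (s' j) (X (s' j)) + (n / (-s' j)) • X (s' j)) := by
      intro j
      have hp : 0 < (-s' j) ^ n := Real.rpow_pos_of_pos (by linarith [hs'0 j]) _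
      have hx : l ^ (m' j) • ((-t) ^ n • y' j) = X (s' j) := by
        simp only [hy']
        rw [smul_smul, smul_smul, pow_mul_rpow_eq hl hρ (m' j) ht, ← hT, hneg_inv _ (hs'0 j), mul_inv_cancel₀ hp.ne',
          one_smul]
      have h := simVel_dss_iterate hl hρ hdss (m' j) ht ((-t) ^ n • y' j)
      rw [hx, ← hT] at h
      simp only [hG]
      exact h.symm
    -- `s' j → −∞`, hence `V (s' j) → 0`
    have hs'_bot : Tendsto s' atTop atBot := by
      have h1 : Tendsto (fun j : ℕ => -(j : ℝ) - 1) atTop atBot :=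
        tendsto_atBot_add_const_right _ (-1) (tendsto_neg_atTop_atBot.comp tendsto_natCast_atTop_atTop)
      refine tendsto_atBot_mono (fun j => ?_) h1
      have h2 := hsqj (φ (j + j₀))
      have h3 := hφge (j + j₀)
      have h4 : (0 : ℝ) ≤ j₀ := Nat.cast_nonneg j₀
      push_cast at h3
      linarith [hs'le j]
    have hG0 : Tendsto (fun j => G (y' j)) atTop (𝓝 0) := by
      refine tendsto_zero_iff_norm_tendsto_zero.2 ((hrest.comp hs'_bot).congr fun j => ?_)
      simp only [Function.comp_apply, hGV j, norm_smul, Real.norm_eq_abs,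
        abs_of_nonneg (Real.rpow_nonneg (by linarith [hs'0 j] : (0:ℝ) ≤ -s' j) _)]
    -- `y' j → ys`: over one period the resting orbit moves by `o(1)`
    have hdiff : Tendsto (fun j => ‖y' j - yq (φ (j + j₀))‖) atTop (𝓝 0) := by
      rw [Metric.tendsto_atTop]
      intro ε hε
      have hε' : 0 < ε / (2 * T) := by positivity
      obtain ⟨N, hN⟩ := eventually_atBot.1 (hrest.eventually (gt_mem_nhds hε'))
      refine ⟨⌈-N⌉₊, fun j hj => ?_⟩
      rw [dist_zero_right, norm_norm]
      have hsN : sq (φ (j + j₀)) ≤ N := by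
        have h2 := hsqj (φ (j + j₀))
        have h3 := hφge (j + j₀)
        have h4 : (-N) ≤ (⌈-N⌉₊ : ℝ) := Nat.le_ceil (-N)
        have h5 : (⌈-N⌉₊ : ℝ) ≤ j := by exact_mod_cast hj
        have h6 : (0 : ℝ) ≤ j₀ := Nat.cast_nonneg j₀
        push_cast at h3
        linarith
      have hmv := norm_simPos_sub_le (n := n) (T := T) (ε := ε / (2 * T)) (hsq0 (φ (j + j₀))) (hs'le j) (hm'1 j) hX
        (fun σ hσ => by
          rw [norm_smul, Real.norm_eq_abs, abs_of_nonneg (Real.rpow_nonneg (by linarith [hσ.2, hsq0 (φ (j + j₀))]) _)]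
          exact (hN σ (hσ.2.trans hsN)).le)
      rw [← norm_neg, neg_sub] at hmv
      simp only [hy', hyq]
      refine lt_of_le_of_lt hmv ?_
      rw [div_mul_eq_mul_div, div_lt_iff₀ (by positivity)]
      nlinarith
    have hy'lim : Tendsto y' atTop (𝓝 ys) := by
      have hyφ : Tendsto (fun j => yq (φ (j + j₀))) atTop (𝓝 ys) := hy_lim.comp (tendsto_add_atTop_nat j₀)
      rw [tendsto_iff_norm_sub_tendsto_zero] at hyφ ⊢
      refine squeeze_zero (fun j => norm_nonneg _) (fun j => ?_) (hdiff.add hyφ |>.trans_eq (by simp))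
      calc ‖y' j - ys‖ = ‖(y' j - yq (φ (j + j₀))) + (yq (φ (j + j₀)) - ys)‖ := by rw [sub_add_sub_cancel]
        _ ≤ ‖y' j - yq (φ (j + j₀))‖ + ‖yq (φ (j + j₀)) - ys‖ := norm_add_le _ _
    -- continuity of `G` and the node equation at phase `t`
    have hGc : Continuous G := by
      have hu : Continuous (u t) := ((hcl.contDiff_velocity (mem_Iio.2 ht)).of_le (by norm_cast)).continuous
      simp only [hG]
      exact ((hu.comp (continuous_id.const_smul ((-t) ^ n))).add
        ((continuous_id.const_smul ((-t) ^ n)).const_smul (n / (-t)))).const_smul ((-t) ^ (1 - n))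
    have hGys : G ys = 0 := tendsto_nhds_unique ((hGc.tendsto ys).comp hy'lim) hG0
    have hpow0 : (-t) ^ (1 - n) ≠ 0 := (Real.rpow_pos_of_pos ht0' _).ne'
    simp only [hG, smul_eq_zero, hpow0, false_or] at hGys
    rw [eq_neg_of_add_eq_zero_left hGys, smul_smul, ← neg_smul, Real.rpow_sub_one ht0'.ne']
    congr 1
    field_simp
  -- contradiction: `ys` is a subcritical permanent node
  have hle := hnode ys hys hperm ts hts0 ws
  rw [hws, one_pow, mul_one] at hle
  linarith

end Summit.NavierStokesRegularity.NavierStokesRegularity.Theorems.PowerGaugeEulerLiouville.SimilarityBernoulli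

end
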